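import Mathlib
import Literature.Analysis.SpecialFunctions.GammaFermatSurface9Triplication
import Summits.HodgeConjecture.HodgeConjecture.Theorems.HodgeLocusCensusChowlaSelbergAnchors
import HarnessLib
import HarnessLib.Audit.Tags

/-!
# HodgeLocusCensusChowlaSelbergAnchorSextic — the N = 1 conifold anchor of the V3-CS layer, now unconditional (cell pub-hlocus, abs-1 gen 8)
HONEST FRAMING: certified instances and evidence bearing on the general Hodge conjecture; no claim.

`HodgeLocusCensusChowlaSelbergAnchors` (abs-1 gen 5, p198348) proves the conifold anchors
`θ_C = -√2, -2^{1/3}√3, -2` of the pencils N = 2, 3, 4 as closed real `Γ`-identities and leaves the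
N = 1 anchor (sextic pencil, `τ_C = i`, `D₀ = -4`, `w₀ = ₂F₁(1/12, 5/12; 1; 1)²`),
`θ_C = -4π² (√π/(Γ(11/12)Γ(7/12)))² / (π (Γ(1/4)/Γ(3/4))²) = -√3`,
conditional on Gauss' triplication formula at `1/4`
(`anchor_sextic_of_triplication (htrip : Γ(1/4) Γ(7/12) Γ(11/12) = 2π · 3^{-1/4} · Γ(3/4))`),
because Mathlib has no multiplication theorem for `Γ`. The tree now has one:
`Literature.Analysis.SpecialFunctions.GaussMultiplication.real_formula` (Andrews–Askey–Roy Thm 1.5.2,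
proved in `GammaMultiplication.lean`) and its `n = 3` case
`Literature.Analysis.SpecialFunctions.Real_Gamma_triplication`
(`Γ(x)Γ(x+1/3)Γ(x+2/3)·3^{3x} = Γ(3x)·√3·2π`, `GammaFermatSurface9Triplication.lean`).
This file discharges `htrip` from that theorem (at `x = 1/4`: `3^{3/4}·3^{-1/4} = √3`) and records the
N = 1 anchor `anchor_sextic` with no hypothesis. All four V3-CS anchors (data/abs/cs/ANCHORS.json,
θ_C⁶ = 27, 8, 108, 64 to ≥ 328 digits in two libraries) are now kernel-checked closed forms.
No new fact, no sorry; classical `Γ`-calculus only.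
-/
namespace Summit.HodgeConjecture.HodgeConjecture.HodgeLocus.Census

open Real

/-- Gauss' triplication formula at `1/4`: `Γ(1/4) Γ(7/12) Γ(11/12) = 2π · 3^{-1/4} · Γ(3/4)`
(the hypothesis `htrip` of `anchor_sextic_of_triplication`), from the tree's
`Real_Gamma_triplication` (`n = 3` case of Andrews–Askey–Roy Thm 1.5.2). -/
theorem Gamma_triplication_at_quarter :
    Gamma (1/4) * Gamma (7/12) * Gamma (11/12) = 2 * π * (3:ℝ) ^ (-(1:ℝ)/4) * Gamma (3/4) := by
  have h := Literature.Analysis.SpecialFunctions.Real_Gamma_triplication (show (0:ℝ) < 1/4 by norm_num)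
  rw [show (1/4 : ℝ) + 1/3 = 7/12 by norm_num, show (1/4 : ℝ) + 2/3 = 11/12 by norm_num,
      show (3 : ℝ) * (1/4) = 3/4 by norm_num] at h
  -- h : Γ(1/4) Γ(7/12) Γ(11/12) · 3^{3/4} = Γ(3/4) · √3 · (2π)
  have h34 : (3:ℝ) ^ ((3:ℝ)/4) * (3:ℝ) ^ (-(1:ℝ)/4) = √3 := by
    rw [← Real.rpow_add (by norm_num : (0:ℝ) < 3), Real.sqrt_eq_rpow]
    norm_num
  have hpos : 0 < (3:ℝ) ^ ((3:ℝ)/4) := Real.rpow_pos_of_pos (by norm_num) _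
  have hs : 0 < (3:ℝ) ^ (-(1:ℝ)/4) := Real.rpow_pos_of_pos (by norm_num) _
  -- multiply h by 3^{-1/4} and use 3^{3/4}·3^{-1/4} = √3
  have key : Gamma (1/4) * Gamma (7/12) * Gamma (11/12) * ((3:ℝ) ^ ((3:ℝ)/4) * (3:ℝ) ^ (-(1:ℝ)/4))
      = Gamma (3/4) * √3 * (2 * π) * (3:ℝ) ^ (-(1:ℝ)/4) := by
    rw [← mul_assoc, h]
  rw [h34] at key
  have h3 : (√3 : ℝ) ≠ 0 := by positivity
  have hsq3 : (√3 : ℝ) * √3 = 3 := Real.mul_self_sqrt (by norm_num)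
  -- cancel √3: from key, LHS·√3 = Γ(3/4)·√3·2π·s
  have : Gamma (1/4) * Gamma (7/12) * Gamma (11/12) = Gamma (3/4) * (2 * π) * (3:ℝ) ^ (-(1:ℝ)/4) := by
    have := key
    field_simp at this
    nlinarith [this, hsq3, h3]
  linarith [this, show Gamma (3/4) * (2 * π) * (3:ℝ) ^ (-(1:ℝ)/4) = 2 * π * (3:ℝ) ^ (-(1:ℝ)/4) * Gamma (3/4) by ring]

/-- ANCHOR N = 1 (sextic pencil, `τ_C = i`, `D₀ = -4`, `w = 4`, `h = 1`; `a = 1/12`, `b = 5/12`), UNCONDITIONAL: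
`θ_C = -4π² (√π/(Γ(11/12)Γ(7/12)))² / (π (Γ(1/4)/Γ(3/4))²) = -√3`
(data/abs/cs/ANCHORS.json: θ_C⁶ = 27 to ≥ 328 digits, two libraries). -/
theorem anchor_sextic :
    -4 * π ^ 2 * (√π / (Gamma (11/12) * Gamma (7/12))) ^ 2 / (π * (Gamma (1/4) / Gamma (3/4)) ^ 2) = -√3 :=
  anchor_sextic_of_triplication Gamma_triplication_at_quarter

/-- The four V3-CS conifold anchors together, all unconditional:
`θ_C(N=1) = -√3`, `θ_C(N=2) = -√2`, `θ_C(N=3) = -2^{1/3}√3`, `θ_C(N=4) = -2`, in the closed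
`Γ`-forms of `HodgeLocusCensusChowlaSelbergAnchors`. -/
theorem anchors_all :
    (-4 * π ^ 2 * (√π / (Gamma (11/12) * Gamma (7/12))) ^ 2 / (π * (Gamma (1/4) / Gamma (3/4)) ^ 2) = -√3)
    ∧ (-4 * π ^ 2 * (√π / (Gamma (7/8) * Gamma (5/8))) ^ 2
        / (π * (Gamma (1/8) * Gamma (3/8) / (Gamma (5/8) * Gamma (7/8)))) = -√2)
    ∧ (-4 * π ^ 2 * (√π / (Gamma (5/6) * Gamma (2/3))) ^ 2
        / (π * (Gamma (1/3) / Gamma (2/3)) ^ 3) = -((2:ℝ) ^ ((1:ℝ)/3) * √3))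
    ∧ (-4 * π ^ 2 * (√π / (Gamma (3/4) * Gamma (3/4))) ^ 2 / (π * (Gamma (1/4) / Gamma (3/4)) ^ 2) = -2) :=
  ⟨anchor_sextic, anchor_quartic, anchor_ci23, anchor_ci222⟩

end Summit.HodgeConjecture.HodgeConjecture.HodgeLocus.Census
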